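import Summits.HubbardSuperconductivity.HubbardSuperconductivity.Theorems.BalabanIRBirEveryGroundStateTransfer
import Summits.HubbardSuperconductivity.HubbardSuperconductivity.Theorems.BalabanIRBirEveryGroundStateLogic
import Summits.HubbardSuperconductivity.HubbardSuperconductivity.Theorems.BalabanIRBirEveryGroundStateSchur

/-!
# STRATEGY-CENSUS sketch (s1) — crux `BirEveryGroundState` (stmt-HubbardSuperconductivity-2083), route BalabanIR
crux-strategist planner-cstrat-stmt-HubbardSuperconductivity-2083-s1-0, 2026-08-17 (gen-1 re-arm after p1).

This scratch file TYPE-CHECKS the NEW switches attempted in `STRATEGY-CENSUS.md` (s1 revision); p1's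
switches live in `census_sketch.lean` (unchanged, still rc 0). Nothing here is proposed to the tree.

* §Strengthen (measure-theoretic, NEW): `SummableDarkMeasureLaw` — window average ⇒ for SOME `ε > 0`
  the Lebesgue measures of the `ε`-dark coupling sets `A_L(ε) ∩ (U₁,U₂)` are SUMMABLE in `L` — and the
  Borel–Cantelli glue `birEveryGroundState_of_summableDarkMeasureLaw : S⁺_BC → crux` PROVED here
  (a.e. coupling of the window is eventually bright; the window has positive measure; pick one).
  Contrapositive bookkeeping `forall_tsum_darkSet_eq_top_of_not_birEveryGroundState`: a counterexample
  must make the dark measures NON-summable for EVERY `ε > 0`.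
* §Decomposition (NEW, D6): the `liminf`/`limsup` split — `InfOftenBrightLaw` (Sub₁: at some coupling
  the bottom of the compression is bright INFINITELY OFTEN in even `L`) and the hypothesis-free
  `BrightRegularityLaw` (Sub₂: infinitely-often bright ⇒ cofinitely bright), glue
  `birEveryGroundState_of_infOften_of_regularity` PROVED (pure logic over `birEveryGroundState_iff_transfer`).
* §Transfer (NEW, T9): `chord_transport` — joint concavity of the two-parameter sector energy
  `(U, κ) ↦ minE_K (T + U•D + κ•Y)` at one point, PROVED: the κ-chord at an interior coupling is bounded
  below by a chord at another coupling MINUS the `U`-concavity defect of the unpenalised energy (which is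
  extensive) — the precise point where "transport the every-GS information across the window" breaks.
-/

set_option linter.dupNamespace false

noncomputable section

namespace Summit.HubbardSuperconductivity.HubbardSuperconductivity.Cruxes.BirEveryGroundState.StrategyCensusS1

open Matrix Finset Filter MeasureTheory
open Literature.Probability.LatticeModels Literature.MathematicalPhysics.QuantumLattice
open Summit.HubbardSuperconductivity.HubbardSuperconductivity.Theorems
open Summit.HubbardSuperconductivity.HubbardSuperconductivity.Theses.BalabanIR
open scoped ComplexOrder ENNReal

/-! ## §0 The crux's hypothesis, verbatim -/

/-- The window-average hypothesis of the crux for data `(δ, U₁, U₂, c)` — the `∀ U ∈ Set.Ioo U₁ U₂, …`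
antecedent of `Theses.BalabanIR.BirEveryGroundState`, verbatim (definitionally equal). [folklore] -/
def WindowAvgHyp (δ U₁ U₂ c : ℝ) : Prop :=
  ∀ U ∈ Set.Ioo U₁ U₂, ∃ L₀ : ℕ, ∀ (L : ℕ) [NeZero L], L₀ ≤ L → Even L →
    let N : ℕ := 2 * ⌊(1 - δ) * (L : ℝ) ^ 2 / 2⌋₊
    let H := hubbardTorus 2 L 1 U
    let S := szSector (Λ := FermionTorus 2 L) N 0
    let E₀ := S ⊓ Module.End.eigenspace (Matrix.toLin' H) ((H.minEnergyOn S : ℝ) : ℂ)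
    let P := projMatrix (E₀.map (Fock.toEuclidean (ι := Orb (FermionTorus 2 L)) :
      Fock (Orb (FermionTorus 2 L)) →ₗ[ℂ] EuclideanSpace ℂ (Finset (Orb (FermionTorus 2 L)))))
    c * (L : ℝ) ^ 4 * P.trace.re ≤
      (P * ((pairField dWaveFormFactor L)ᴴ * pairField dWaveFormFactor L)).trace.re

/-! ## §Strengthen (NEW, measure-theoretic) — S⁺_BC, the summable-dark-measure law -/

/-- The `ε`-DARK SET OF COUPLINGS at side `L` and doping `δ`: the couplings `U` at which some
normalised `(2⌊(1-δ)L²/2⌋, S^z = 0)`-sector ground state `ψ` of `hubbardTorus 2 L 1 U` has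
`re ⟨ψ, Δ_d†Δ_d ψ⟩ < ε L⁴` (a pair-dark ground direction). For `L = 0` (no `NeZero` instance) it is
empty. By Rellich it is, inside any window, a finite set of crossing points plus the sub-intervals on
which the (permanently degenerate) bottom cluster carries an `ε`-dark direction. [folklore] -/
def darkSet (δ ε : ℝ) (L : ℕ) : Set ℝ :=
  {U | ∃ _ : NeZero L, ∃ ψ : Fock (Orb (FermionTorus 2 L)),
      IsGroundStateInSector (hubbardTorus 2 L 1 U) (2 * ⌊(1 - δ) * (L : ℝ) ^ 2 / 2⌋₊) 0 ψ ∧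
      star ψ ⬝ᵥ ψ = 1 ∧
      (star ψ ⬝ᵥ ((pairField dWaveFormFactor L)ᴴ * pairField dWaveFormFactor L) *ᵥ ψ).re <
        ε * (L : ℝ) ^ 4}

/-- **S⁺_BC, the summable-dark-measure law** (a ∀-window Hubbard law, STRONGER than the crux):
the window-average hypothesis on `(U₁,U₂)` implies that for SOME `ε > 0` the Lebesgue measures of the
`ε`-dark coupling sets inside the window are summable over the sides `L`. It replaces the crux's
"∃ one good coupling" by a quantitative per-side statement about HOW MUCH of the window is dark. -/
def SummableDarkMeasureLaw : Prop :=
  ∀ (δ U₁ U₂ c : ℝ), δ ∈ Set.Ioo (0:ℝ) (1/2) → 0 < U₁ → U₁ < U₂ → 0 < c →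
    WindowAvgHyp δ U₁ U₂ c →
    ∃ ε : ℝ, 0 < ε ∧ (∑' L : ℕ, volume (darkSet δ ε L ∩ Set.Ioo U₁ U₂)) ≠ ∞

/-- **Borel–Cantelli glue: S⁺_BC closes the crux BY NAME.** If the dark measures are summable for
some `ε > 0`, then (first Borel–Cantelli lemma, `MeasureTheory.measure_limsup_atTop_eq_zero`) Lebesgue-a.e.
coupling of the window lies in only finitely many dark sets, i.e. is EVENTUALLY `ε`-bright at the
bottom of the compression; the window has positive measure, so such a coupling exists, and the
transfer form of the crux (`birEveryGroundState_iff_transfer`) concludes with `c' = ε`. [folklore] -/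
theorem birEveryGroundState_of_summableDarkMeasureLaw (h : SummableDarkMeasureLaw) :
    BirEveryGroundState := by
  rw [birEveryGroundState_iff_transfer]
  intro δ U₁ U₂ c hδ hU₁ hU₁₂ hc hyp
  obtain ⟨ε, hε, hsum⟩ := h δ U₁ U₂ c hδ hU₁ hU₁₂ hc hyp
  set s : ℕ → Set ℝ := fun L => darkSet δ ε L ∩ Set.Ioo U₁ U₂ with hs
  have hlim : volume (Filter.limsup s Filter.atTop) = 0 := measure_limsup_atTop_eq_zero hsum
  have hW : ¬ (Set.Ioo U₁ U₂ ⊆ Filter.limsup s Filter.atTop) := by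
    intro hsub
    have h1 : volume (Set.Ioo U₁ U₂) ≤ volume (Filter.limsup s Filter.atTop) := measure_mono hsub
    rw [hlim, Real.volume_Ioo] at h1
    have h2 : (0 : ℝ≥0∞) < ENNReal.ofReal (U₂ - U₁) := ENNReal.ofReal_pos.mpr (by linarith)
    exact absurd h1 (not_le.mpr h2)
  obtain ⟨U, hUW, hUnot⟩ := Set.not_subset.mp hW
  refine ⟨U, hUW, ε, hε, ?_⟩
  rw [Filter.mem_limsup_iff_frequently_mem, Filter.not_frequently] at hUnot
  obtain ⟨L₀, hL₀⟩ := Filter.eventually_atTop.mp hUnot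
  refine ⟨L₀, fun L _ hL hLe ψ hgs hunit => ?_⟩
  by_contra hlt
  push Not at hlt
  exact hL₀ L hL ⟨⟨‹NeZero L›, ψ, hgs, hunit, hlt⟩, hUW⟩

/-- **What a counterexample must do, measure-theoretically** (contrapositive bookkeeping): if the crux
fails then there are data satisfying the window-average hypothesis such that for EVERY `ε > 0` the
dark measures `|A_L(ε) ∩ (U₁,U₂)|` are NOT summable in `L` — since each `A_L(ε) ∩ (U₁,U₂)` is (up to
finitely many crossing points) a union of dominance intervals of permanently degenerate bottom clusters
with a dark direction, a refutation needs such intervals of non-summable total length. [folklore] -/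
theorem forall_tsum_darkSet_eq_top_of_not_birEveryGroundState (h : ¬ BirEveryGroundState) :
    ∃ δ U₁ U₂ c : ℝ, δ ∈ Set.Ioo (0:ℝ) (1/2) ∧ 0 < U₁ ∧ U₁ < U₂ ∧ 0 < c ∧
      WindowAvgHyp δ U₁ U₂ c ∧
      ∀ ε : ℝ, 0 < ε → (∑' L : ℕ, volume (darkSet δ ε L ∩ Set.Ioo U₁ U₂)) = ∞ := by
  by_contra hcon
  push Not at hcon
  exact h (birEveryGroundState_of_summableDarkMeasureLaw
    (fun δ U₁ U₂ c hδ hU₁ hU₁₂ hc hyp => hcon δ U₁ U₂ c hδ hU₁ hU₁₂ hc hyp))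

/-! ## §Decomposition (NEW, D6) — the liminf / limsup split -/

/-- Sub₁ (limsup form of the crux): the window average yields ONE coupling at which the bottom of the
compression of `Δ_d†Δ_d` to the sector ground eigenspace is `≥ c' L⁴` for INFINITELY MANY even sides
(instead of cofinitely many). Weaker than the crux's transfer form; at side `L` it holds at every
coupling whose bottom cluster is a single `G_L`-isotypic irreducible multiplet (Schur), so it asks
only that NOT all of the window be covered by coincidence clusters, infinitely often — the weakest
form of kind (A), still source-less. -/
def InfOftenBrightLaw : Prop :=
  ∀ (δ U₁ U₂ c : ℝ), δ ∈ Set.Ioo (0:ℝ) (1/2) → 0 < U₁ → U₁ < U₂ → 0 < c →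
    WindowAvgHyp δ U₁ U₂ c →
    ∃ U ∈ Set.Ioo U₁ U₂, ∃ c' : ℝ, 0 < c' ∧ ∀ L₀ : ℕ, ∃ (L : ℕ) (_ : NeZero L), L₀ ≤ L ∧ Even L ∧
      ∀ ψ : Fock (Orb (FermionTorus 2 L)),
        IsGroundStateInSector (hubbardTorus 2 L 1 U) (2 * ⌊(1 - δ) * (L : ℝ) ^ 2 / 2⌋₊) 0 ψ →
        star ψ ⬝ᵥ ψ = 1 →
        c' * (L : ℝ) ^ 4 ≤
          (star ψ ⬝ᵥ ((pairField dWaveFormFactor L)ᴴ * pairField dWaveFormFactor L) *ᵥ ψ).re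

/-- Sub₂ (hypothesis-free REGULARITY IN `L`): at a repulsive coupling, an infinitely-often bright
bottom is a cofinitely bright bottom. FALSE in the abstract (alternate bright and dark sides) and
implausible for Hubbard tori as a law (open/closed-shell alternation with `L mod 4` changes the ground
multiplet); recorded to show where the `liminf` of the summit bites. -/
def BrightRegularityLaw : Prop :=
  ∀ (δ U c' : ℝ), δ ∈ Set.Ioo (0:ℝ) (1/2) → 0 < U → 0 < c' →
    (∀ L₀ : ℕ, ∃ (L : ℕ) (_ : NeZero L), L₀ ≤ L ∧ Even L ∧
      ∀ ψ : Fock (Orb (FermionTorus 2 L)),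
        IsGroundStateInSector (hubbardTorus 2 L 1 U) (2 * ⌊(1 - δ) * (L : ℝ) ^ 2 / 2⌋₊) 0 ψ →
        star ψ ⬝ᵥ ψ = 1 →
        c' * (L : ℝ) ^ 4 ≤
          (star ψ ⬝ᵥ ((pairField dWaveFormFactor L)ᴴ * pairField dWaveFormFactor L) *ᵥ ψ).re) →
    ∃ c'' : ℝ, 0 < c'' ∧ ∃ L₀ : ℕ, ∀ (L : ℕ) [NeZero L], L₀ ≤ L → Even L →
      ∀ ψ : Fock (Orb (FermionTorus 2 L)),
        IsGroundStateInSector (hubbardTorus 2 L 1 U) (2 * ⌊(1 - δ) * (L : ℝ) ^ 2 / 2⌋₊) 0 ψ →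
        star ψ ⬝ᵥ ψ = 1 →
        c'' * (L : ℝ) ^ 4 ≤
          (star ψ ⬝ᵥ ((pairField dWaveFormFactor L)ᴴ * pairField dWaveFormFactor L) *ᵥ ψ).re

/-- Glue of the split D6: `Sub₁ → Sub₂ → crux` (pure logic over the transfer form). [folklore] -/
theorem birEveryGroundState_of_infOften_of_regularity (h₁ : InfOftenBrightLaw)
    (h₂ : BrightRegularityLaw) : BirEveryGroundState := by
  rw [birEveryGroundState_iff_transfer]
  intro δ U₁ U₂ c hδ hU₁ hU₁₂ hc hyp
  obtain ⟨U, hU, c', hc', hio⟩ := h₁ δ U₁ U₂ c hδ hU₁ hU₁₂ hc hyp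
  obtain ⟨c'', hc'', L₀, hL₀⟩ := h₂ δ U c' hδ (hU₁.trans hU.1) hc' hio
  exact ⟨U, hU, c'', hc'', L₀, fun L _ hL hLe => hL₀ L hL hLe⟩

/-! ## §Transfer (NEW, T9) — chord transport across couplings by joint concavity -/

section ChordTransport

variable {n : Type*} [Fintype n]

private theorem re_rayleigh_add_smul (H M : Matrix n n ℂ) (c : ℝ) (φ : n → ℂ) :
    (star φ ⬝ᵥ (H + (c : ℂ) • M) *ᵥ φ).re =
      (star φ ⬝ᵥ H *ᵥ φ).re + c * (star φ ⬝ᵥ M *ᵥ φ).re := by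
  rw [add_mulVec, dotProduct_add, Complex.add_re, smul_mulVec, dotProduct_smul, smul_eq_mul,
    Complex.re_ofReal_mul]

/-- **Chord transport (joint concavity of the two-parameter sector energy at one point).** For any
matrices `T, D, Y`, sector `K` containing a unit vector, couplings `U_a, U_b`, source `κ` and
`t ∈ (0,1]`: with `U* = t U_a + (1-t) U_b`,
`t · minE_K(T + U_a D + (κ/t) Y) + (1-t) · minE_K(T + U_b D) ≤ minE_K(T + U* D + κ Y)`.
Hence `chord(U*, κ) ≥ t · chord(U_a, κ/t) − Def(U_a, U_b; t)` with the `U`-concavity defect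
`Def = minE_K(T + U* D) − t minE_K(T + U_a D) − (1-t) minE_K(T + U_b D) ≥ 0` of the UNPENALISED
energy: every-ground-state (chord) information moves across the window only modulo `Def`, which for
`D = Σ_x n_{x↑}n_{x↓}` is extensive (`~ L² (ΔU)² × curvature of the energy density`) while chords are
`O(κ) = O(1)` — the breaking point of switch T9. Griffiths (1966) §II; folklore. [folklore] -/
theorem chord_transport (T D Y : Matrix n n ℂ) (K : Submodule ℂ (n → ℂ))
    (hne : ∃ ψ ∈ K, star ψ ⬝ᵥ ψ = 1) (Ua Ub κ t : ℝ) (ht0 : 0 < t) (ht1 : t ≤ 1) :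
    t * (T + (Ua : ℂ) • D + ((κ / t : ℝ) : ℂ) • Y).minEnergyOn K +
        (1 - t) * (T + (Ub : ℂ) • D).minEnergyOn K ≤
      (T + ((t * Ua + (1 - t) * Ub : ℝ) : ℂ) • D + (κ : ℂ) • Y).minEnergyOn K := by
  obtain ⟨ψ₀, hψ₀K, hψ₀⟩ := hne
  change _ ≤ sInf _
  refine le_csInf ⟨_, ψ₀, hψ₀K, hψ₀, rfl⟩ ?_
  rintro b ⟨ψ, hψK, hψ, rfl⟩
  have h1 := minEnergyOn_le_re_rayleigh (T + (Ua : ℂ) • D + ((κ / t : ℝ) : ℂ) • Y) K hψK hψ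
  have h2 := minEnergyOn_le_re_rayleigh (T + (Ub : ℂ) • D) K hψK hψ
  rw [re_rayleigh_add_smul, re_rayleigh_add_smul] at h1
  rw [re_rayleigh_add_smul] at h2
  rw [re_rayleigh_add_smul, re_rayleigh_add_smul]
  have hkt : t * (κ / t) = κ := by field_simp
  set eT := (star ψ ⬝ᵥ T *ᵥ ψ).re
  set eD := (star ψ ⬝ᵥ D *ᵥ ψ).re
  set eY := (star ψ ⬝ᵥ Y *ᵥ ψ).re
  have h1' := mul_le_mul_of_nonneg_left h1 ht0.le
  have h2' := mul_le_mul_of_nonneg_left h2 (sub_nonneg.2 ht1)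
  have key : t * (eT + Ua * eD + κ / t * eY) + (1 - t) * (eT + Ub * eD) =
      eT + (t * Ua + (1 - t) * Ub) * eD + κ * eY := by
    have : t * (κ / t * eY) = κ * eY := by rw [← mul_assoc, hkt]
    linear_combination this
  linarith [h1', h2', key]

end ChordTransport

end Summit.HubbardSuperconductivity.HubbardSuperconductivity.Cruxes.BirEveryGroundState.StrategyCensusS1
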